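import Summits.QuantumFields.YangMills.Theorems.BalabanLadderNTCanonicalEnvelopes
import Summits.QuantumFields.YangMills.Theorems.BalabanLadderROTBoundaryDecayGuard
import Summits.QuantumFields.YangMills.Theorems.LangevinControlUVOSLegsFromFemtoAndGapStubCollar
import Literature.LinearAlgebra.Matrix.TraceSingularValueInequality
import Literature.MathematicalPhysics.QuantumFieldTheory.WilsonPartitionRegularVariationProofs
import Literature.MathematicalPhysics.QuantumLattice.LatticeGaugeDLRCovarianceSplit
import HarnessLib

/-!
# Crux `NT` (stmt-QuantumFields-19353), stub `stub_refpkgT : RefPkgT`: THE CORNER PRICE — clause 1 read on the unit cube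
# forces `C₁ ≥ 6 (N − Re tr ρ(g))` for every `g ∈ G`, hence an `ε`-independent floor of the registered clause-4 margin

Helper file (`--supports stmt-QuantumFields-19353`) of the fleet lead prover of crux `NT` (unit `ym-spine-19353-p1`, GEN 13).
Hypothesis-free, general compact `G`, any lattice representation `r`.

THE OBSERVATION.  Clause 1 of the registered package (skeleton v4T 4297522f58b4c3a5) asks, for EVERY cube `(c, b)` with
`b · a(β) ≤ ℓ`, EVERY pair of exteriors `η, η'` and every site of depth `≥ 1`,
`|kerE^η(dens_x) − kerE^{η'}(dens_x)| ≤ C₁ / depth⁴`.  The unit cube `b = 1` is admitted (eventually `a(β) ≤ ℓ`): it has NO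
interior link, its site has depth `1` (tree, ROT desk: `ROT.kerE_one_eq_self`, `ROT.depth_one_self`), so the kernel mean
of the (corner-based) action density `dens_c = Σ_{i<j} Re tr ρ(U_{p_{ij}(c)})` is its VALUE at the exterior.  An exterior
putting the holonomy `g` on all six plaquettes based at `c` exists for every `g` (§1), whence

* §2 `six_mul_abs_trace_sub_le_of_e1osc_at` — clause 1 at one coupling (spacing `s ≤ ℓ`) forces
  **`6 · |Re tr ρ(g) − Re tr ρ(g')| ≤ C₁`** for all `g, g'`; `six_mul_sub_trace_le_of_e1osc_at` — **`6 (N − Re tr ρ(g)) ≤ C₁`**;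
  `C₁_pos_of_e1osc_at` — `0 < C₁` as soon as `G` is non-trivial (faithfulness of `ρ`; the equality case
  `Re tr U = N ↔ U = 1` of the tree's Horn–Johnson file) — from clause 1 ALONE (GEN 12's `C₁_pos_of_e1osc_floor₂` needed
  the clause-4 floor);
* §3 the same β-uniformly for the registered clause (`∃ β₁ ∀ β ≥ β₁ …`, any unit map with `a β ≤ ℓ` frequently, e.g.
  `a → 0`, `ℓ > 0`): `six_mul_abs_trace_sub_le_of_e1osc`, `six_mul_sub_trace_le_of_e1osc`;
* §4 THE CORNER FLOOR OF THE MARGIN: the `k·k′` part of the registered clause-4 margin is monotone in `C₁`, so on every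
  reference torus **`Q2(θv, v) ≥ ε + 2·(D(s/κ)⁴S_θ)(D(s/κ)⁴S_v)`** with `D = 6(N − Re tr ρ(g))` for ANY `g`
  (`q2_ge_cornerMargin_of_clause4_at`), and canonically (GEN 12's `marginKK_tendsto_canonical`) for every `e > 0`
  eventually **`Q2_{β,L₀β,aβ}(θv, v) ≥ ε + 2D²‖v‖₁²/κ⁸ − e`** (`q2_ge_cornerMargin_canonical`): whatever `ε` is, a package
  instance exhibits a reference two-point function of at least `72 (N − Re tr ρ(g))² ‖v‖₁² / κ⁸`.

NUMBERS (memo SIZING-19353-g13 §2): `SU(2)` fundamental (`Re tr ∈ [−2, 2]`): `C₁ ≥ 24`, corner floor `1152 ‖v‖₁²/κ⁸`;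
`SU(3)` fundamental (`Re tr ∈ [−3/2, 3]`): `C₁ ≥ 27`, corner floor `1458 ‖v‖₁²/κ⁸`.  The registered `1 ≤ depth` shape makes
the one-point constant a LATTICE-CORNER quantity (β-independent, O(N)), not a deep-interior one; a collar-depth re-cut
(`κ/aβ ≤ depth`, the shape of `…ReferenceTorusCollar`) escapes this price (located remark, memo §3).

HONEST FRAMING.  Finite bookkeeping over tree theorems; a necessary condition on instances of the registered stub; no floor,
not AF, not NT, not the seam, not the gap; not Clay.
-/

set_option autoImplicit false

noncomputable section

open scoped SchwartzMap
open MeasureTheory Filter Topology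
open Literature.MathematicalPhysics.QuantumFieldTheory Literature.MathematicalPhysics.QuantumLattice
open Literature.Probability.LatticeModels
open Summit.QuantumFields.YangMills.Cruxes.OSLegsFromFemtoAndGap.DlrCollarTransfer

namespace Summit.QuantumFields.YangMills.Cruxes.NT.CornerPrice

/-! ## §1 The corner exterior: all six plaquettes based at `c` carry the holonomy `g` -/

section Corner

variable {G : Type} [Group G] [TopologicalSpace G] [IsTopologicalGroup G] [CompactSpace G]
  [MeasurableSpace G] [BorelSpace G]

/-- `Pi.single k 1 = Pi.single k' 1` in `ℤ⁴` iff `k = k'`. [folklore] -/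
theorem single_one_eq_single_one_iff {k k' : Fin 4} :
    (Pi.single k (1 : ℤ) : Fin 4 → ℤ) = Pi.single k' 1 ↔ k = k' := by
  refine ⟨fun h => ?_, fun h => by rw [h]⟩
  by_contra hne
  have h1 := congr_fun h k
  rw [Pi.single_eq_same, Pi.single_apply, if_neg hne] at h1
  exact one_ne_zero h1

/-- **The corner exterior.**  For every site `c` and every `g ∈ G` there is a configuration in which all six plaquettes
based at `c` have holonomy `g`, so that the action density at `c` equals `6 · Re tr ρ(g)`. [folklore] -/
theorem exists_exterior_dens_eq (r : LatticeRep G) (c : Fin 4 → ℤ) (g : G) :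
    ∃ η : LGConfig 4 G, dens G r c η = 6 * (r.ρ g).trace.re := by
  classical
  refine ⟨fun e => if ∃ k : Fin 4, k < e.2 ∧ e.1 = c + Pi.single k 1 then g else 1, ?_⟩
  set η : LGConfig 4 G := fun e => if ∃ k : Fin 4, k < e.2 ∧ e.1 = c + Pi.single k 1 then g else 1 with hη
  -- the four links of the plaquette `(c; i, j)`, `i < j`
  have hbase : ∀ m : Fin 4, η (c, m) = 1 := fun m => by
    rw [hη]
    dsimp only
    rw [if_neg]
    rintro ⟨k, -, hk⟩
    have := congr_fun hk k
    simp at this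
  have hshift : ∀ i m : Fin 4, η (Pi.single i 1 + c, m) = if i < m then g else 1 := fun i m => by
    rw [hη]
    dsimp only
    by_cases him : i < m
    · rw [if_pos ⟨i, him, add_comm _ _⟩, if_pos him]
    · rw [if_neg, if_neg him]
      rintro ⟨k, hk, hck⟩
      rw [add_comm] at hck
      have hki : i = k := single_one_eq_single_one_iff.1 (add_left_cancel hck)
      exact him (hki ▸ hk)
  have hhol : ∀ i j : Fin 4, i < j → plaquetteHolonomyZd (configShift (-c) η) 0 i j = g := fun i j hij => by
    have hji : ¬ j < i := not_lt.2 hij.le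
    simp only [plaquetteHolonomyZd, Literature.MathematicalPhysics.QuantumLattice.configShift_apply, sub_neg_eq_add,
      zero_add, hbase, hshift, if_pos hij, if_neg hji, one_mul, inv_one, mul_one]
  -- the density
  show actionDensity r.ρ (configShift (-c) η) = 6 * (r.ρ g).trace.re
  unfold actionDensity
  rw [← sum_pairs_fin_four]
  refine Finset.sum_congr rfl fun i _ => Finset.sum_congr rfl fun j _ => ?_
  by_cases hij : i < j
  · rw [if_pos hij, if_pos hij, plaquetteObs, hhol i j hij]
  · rw [if_neg hij, if_neg hij]

/-- On the unit cube `(c, 1)` the kernel mean of the action density at `c` is its value at the exterior (no link is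
integrated; tree `ROT.kerE_one_eq_self`). [folklore] -/
theorem kerE_one_dens_eq (r : LatticeRep G) (β : ℝ) (c : Fin 4 → ℤ) (η : LGConfig 4 G) :
    kerE G r β c 1 η (dens G r c) = dens G r c η :=
  Summit.QuantumFields.YangMills.Theorems.ROT.kerE_one_eq_self r β c
    (r.curvature.measurable.comp (Literature.MathematicalPhysics.QuantumLattice.configShift (-c)).measurable)
    (isCylinder_dens r c) η

end Corner

section Trace

variable {G : Type} [Group G] [TopologicalSpace G]

/-- `Re tr ρ(g) = N` iff `g = 1`, for the faithful unitary `ρ` of a lattice representation. [folklore] -/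
theorem trace_re_eq_N_iff (r : LatticeRep G) (g : G) : (r.ρ g).trace.re = r.N ↔ g = 1 := by
  have h := Literature.LinearAlgebra.Matrix.re_trace_eq_card_iff_of_mem_unitaryGroup (r.mem_unitary g)
  simp only [RCLike.re_to_complex, Fintype.card_fin] at h
  rw [h]
  constructor
  · intro hg
    exact r.injective (by rw [hg, map_one])
  · rintro rfl
    exact map_one _

/-- The corner price is non-negative: `0 ≤ 6 (N − Re tr ρ(g))`. [folklore] -/
theorem six_mul_sub_trace_nonneg (r : LatticeRep G) (g : G) : 0 ≤ 6 * ((r.N : ℝ) - (r.ρ g).trace.re) :=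
  mul_nonneg (by norm_num) (sub_nonneg.2 (r.re_trace_le g))

/-- The corner price is positive at every `g ≠ 1` (faithfulness). [folklore] -/
theorem six_mul_sub_trace_pos (r : LatticeRep G) {g : G} (hg : g ≠ 1) : 0 < 6 * ((r.N : ℝ) - (r.ρ g).trace.re) := by
  refine mul_pos (by norm_num) (sub_pos.2 (lt_of_le_of_ne (r.re_trace_le g) fun h => hg ?_))
  exact (trace_re_eq_N_iff r g).1 h

end Trace

/-! ## §2 The corner price at one coupling -/

section OneCoupling

variable (G : Type) [Group G] [TopologicalSpace G] [IsTopologicalGroup G] [CompactSpace G]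
  [MeasurableSpace G] [BorelSpace G] (r : LatticeRep G)

/-- **The corner price, one coupling.**  Clause 1 (E1-osc at coupling `β`, spacing `s`, range `ℓ ≥ s`, constant `C₁`)
forces `6 · |Re tr ρ(g) − Re tr ρ(g')| ≤ C₁` for all `g, g' ∈ G`: read it on the unit cube at the origin with the two
corner exteriors. [folklore] -/
theorem six_mul_abs_trace_sub_le_of_e1osc_at (β : ℝ) {C₁ ℓ s : ℝ} (hsℓ : s ≤ ℓ)
    (hE1 : ∀ (c : Fin 4 → ℤ) (b : ℕ), (b : ℝ) * s ≤ ℓ → ∀ (η η' : LGConfig 4 G) (x : Fin 4 → ℤ),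
      1 ≤ depth c b x → |kerE G r β c b η (dens G r x) - kerE G r β c b η' (dens G r x)| ≤ C₁ / (depth c b x : ℝ) ^ 4)
    (g g' : G) : 6 * |(r.ρ g).trace.re - (r.ρ g').trace.re| ≤ C₁ := by
  obtain ⟨η, hη⟩ := exists_exterior_dens_eq r 0 g
  obtain ⟨η', hη'⟩ := exists_exterior_dens_eq r 0 g'
  have hd := Summit.QuantumFields.YangMills.Theorems.ROT.depth_one_self (0 : Fin 4 → ℤ)
  have h := hE1 0 1 (by simpa using hsℓ) η η' 0 (by rw [hd])
  rw [kerE_one_dens_eq, kerE_one_dens_eq, hη, hη', hd] at h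
  simpa [← mul_sub, abs_mul] using h

/-- **`C₁ ≥ 6 (N − Re tr ρ(g))`** for every `g ∈ G` (the corner price against the trivial exterior). [folklore] -/
theorem six_mul_sub_trace_le_of_e1osc_at (β : ℝ) {C₁ ℓ s : ℝ} (hsℓ : s ≤ ℓ)
    (hE1 : ∀ (c : Fin 4 → ℤ) (b : ℕ), (b : ℝ) * s ≤ ℓ → ∀ (η η' : LGConfig 4 G) (x : Fin 4 → ℤ),
      1 ≤ depth c b x → |kerE G r β c b η (dens G r x) - kerE G r β c b η' (dens G r x)| ≤ C₁ / (depth c b x : ℝ) ^ 4)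
    (g : G) : 6 * ((r.N : ℝ) - (r.ρ g).trace.re) ≤ C₁ := by
  have h := six_mul_abs_trace_sub_le_of_e1osc_at G r β hsℓ hE1 1 g
  rw [map_one, Matrix.trace_one] at h
  simp only [Complex.natCast_re, Fintype.card_fin] at h
  exact (mul_le_mul_of_nonneg_left (le_abs_self _) (by norm_num)).trans h

/-- **`0 < C₁` from clause 1 alone**, for every non-trivial gauge group. [folklore] -/
theorem C₁_pos_of_e1osc_at [Nontrivial G] (β : ℝ) {C₁ ℓ s : ℝ} (hsℓ : s ≤ ℓ)
    (hE1 : ∀ (c : Fin 4 → ℤ) (b : ℕ), (b : ℝ) * s ≤ ℓ → ∀ (η η' : LGConfig 4 G) (x : Fin 4 → ℤ),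
      1 ≤ depth c b x → |kerE G r β c b η (dens G r x) - kerE G r β c b η' (dens G r x)| ≤ C₁ / (depth c b x : ℝ) ^ 4) :
    0 < C₁ := by
  obtain ⟨g, hg⟩ := exists_ne (1 : G)
  exact (six_mul_sub_trace_pos r hg).trans_le (six_mul_sub_trace_le_of_e1osc_at G r β hsℓ hE1 g)

end OneCoupling

/-! ## §3 The corner price for the registered clause 1 (β-uniform constant) -/

section Package

variable (G : Type) [Group G] [TopologicalSpace G] [IsTopologicalGroup G] [CompactSpace G]
  [MeasurableSpace G] [BorelSpace G] (r : LatticeRep G)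

/-- A unit map tending to `0` is eventually below any positive range. [folklore] -/
theorem eventually_le_of_tendsto_zero {a : ℝ → ℝ} (ha0 : Tendsto a atTop (𝓝 0)) {ℓ : ℝ} (hℓ : 0 < ℓ) :
    ∀ᶠ β in atTop, a β ≤ ℓ :=
  (ha0.eventually (ge_mem_nhds hℓ)).mono fun _ h => h

/-- **The corner price, registered clause.**  If clause 1 holds for `β ≥ β₁` in a unit map `a` with `a β ≤ ℓ` for
arbitrarily large `β` (e.g. `a → 0`, `ℓ > 0`), then `6 · |Re tr ρ(g) − Re tr ρ(g')| ≤ C₁` for all `g, g'`. [folklore] -/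
theorem six_mul_abs_trace_sub_le_of_e1osc (a : ℝ → ℝ) {C₁ ℓ : ℝ} (haℓ : ∃ᶠ β in atTop, a β ≤ ℓ)
    (hE1 : ∃ β₁ : ℝ, ∀ β : ℝ, β₁ ≤ β → ∀ (c : Fin 4 → ℤ) (b : ℕ), (b : ℝ) * a β ≤ ℓ →
      ∀ (η η' : LGConfig 4 G) (x : Fin 4 → ℤ), 1 ≤ depth c b x →
        |kerE G r β c b η (dens G r x) - kerE G r β c b η' (dens G r x)| ≤ C₁ / (depth c b x : ℝ) ^ 4)
    (g g' : G) : 6 * |(r.ρ g).trace.re - (r.ρ g').trace.re| ≤ C₁ := by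
  obtain ⟨β₁, H1⟩ := hE1
  obtain ⟨β, hβℓ, hβ1⟩ := (haℓ.and_eventually (eventually_ge_atTop β₁)).exists
  exact six_mul_abs_trace_sub_le_of_e1osc_at G r β hβℓ (H1 β hβ1) g g'

/-- **`C₁ ≥ 6 (N − Re tr ρ(g))`** for the registered clause 1 (any unit map `a → 0`, range `ℓ > 0`). [folklore] -/
theorem six_mul_sub_trace_le_of_e1osc (a : ℝ → ℝ) (ha0 : Tendsto a atTop (𝓝 0)) {C₁ ℓ : ℝ} (hℓ : 0 < ℓ)
    (hE1 : ∃ β₁ : ℝ, ∀ β : ℝ, β₁ ≤ β → ∀ (c : Fin 4 → ℤ) (b : ℕ), (b : ℝ) * a β ≤ ℓ →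
      ∀ (η η' : LGConfig 4 G) (x : Fin 4 → ℤ), 1 ≤ depth c b x →
        |kerE G r β c b η (dens G r x) - kerE G r β c b η' (dens G r x)| ≤ C₁ / (depth c b x : ℝ) ^ 4)
    (g : G) : 6 * ((r.N : ℝ) - (r.ρ g).trace.re) ≤ C₁ := by
  obtain ⟨β₁, H1⟩ := hE1
  obtain ⟨β, hβℓ, hβ1⟩ :=
    (((eventually_le_of_tendsto_zero ha0 hℓ).and (eventually_ge_atTop β₁)).frequently).exists
  exact six_mul_sub_trace_le_of_e1osc_at G r β hβℓ (H1 β hβ1) g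

/-- **`0 < C₁` for the registered clause 1**, every non-trivial `G` (no floor needed). [folklore] -/
theorem C₁_pos_of_e1osc [Nontrivial G] (a : ℝ → ℝ) (ha0 : Tendsto a atTop (𝓝 0)) {C₁ ℓ : ℝ} (hℓ : 0 < ℓ)
    (hE1 : ∃ β₁ : ℝ, ∀ β : ℝ, β₁ ≤ β → ∀ (c : Fin 4 → ℤ) (b : ℕ), (b : ℝ) * a β ≤ ℓ →
      ∀ (η η' : LGConfig 4 G) (x : Fin 4 → ℤ), 1 ≤ depth c b x →
        |kerE G r β c b η (dens G r x) - kerE G r β c b η' (dens G r x)| ≤ C₁ / (depth c b x : ℝ) ^ 4) :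
    0 < C₁ := by
  obtain ⟨g, hg⟩ := exists_ne (1 : G)
  exact (six_mul_sub_trace_pos r hg).trans_le (six_mul_sub_trace_le_of_e1osc G r a ha0 hℓ hE1 g)

end Package

/-! ## §4 The corner floor of the registered clause-4 margin -/

section Margin

variable (G : Type) [Group G] [TopologicalSpace G] [IsTopologicalGroup G] [CompactSpace G]
  [MeasurableSpace G] [BorelSpace G] (r : LatticeRep G)

/-- Monotonicity of the `k·k′` term in the one-point constant. [folklore] -/
theorem marginKK_mono {D C₁ t Sθ Sv : ℝ} (hD : 0 ≤ D) (hDC : D ≤ C₁) (ht : 0 ≤ t) (hSθ : 0 ≤ Sθ) (hSv : 0 ≤ Sv) :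
    2 * (D * t * Sθ) * (D * t * Sv) ≤ 2 * (C₁ * t * Sθ) * (C₁ * t * Sv) := by
  have h1 : D * t * Sθ ≤ C₁ * t * Sθ := by gcongr
  have h2 : D * t * Sv ≤ C₁ * t * Sv := by gcongr
  have h0 : 0 ≤ D * t * Sθ := by positivity
  have h0' : 0 ≤ D * t * Sv := by positivity
  nlinarith [mul_le_mul h1 h2 h0' (h0.trans h1)]

/-- **The corner floor of the margin, one coupling.**  At coupling `β`, spacing `s ≤ ℓ`: clause 1 (constant `C₁`, range
`ℓ`) and the registered clause-4 inequality on a torus `2L+1` (only `0 ≤ C₂` is used) give, for EVERY `g ∈ G` with `D := 6 (N − Re tr ρ(g))`,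
`ε + 2 (D (s/κ)⁴ S_θ)(D (s/κ)⁴ S_v) ≤ Q2_{β,L,s}(θv, v)`. [folklore] -/
theorem q2_ge_cornerMargin_of_clause4_at (β : ℝ) {C₁ C₂ ℓ s κ : ℝ} (hC₂ : 0 ≤ C₂) (hsℓ : s ≤ ℓ)
    (hE1 : ∀ (c : Fin 4 → ℤ) (b : ℕ), (b : ℝ) * s ≤ ℓ → ∀ (η η' : LGConfig 4 G) (x : Fin 4 → ℤ),
      1 ≤ depth c b x → |kerE G r β c b η (dens G r x) - kerE G r β c b η' (dens G r x)| ≤ C₁ / (depth c b x : ℝ) ^ 4)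
    {v : 𝓢(EuclideanSpace ℝ (Fin 4), ℝ)} {ε : ℝ} {L : ℕ}
    (hfloor : ε + 2 * (C₁ * (s / κ) ^ 4 * ∑ x ∈ box 4 L, |thetaTest 4 v (s • siteToE x)|) *
          (C₁ * (s / κ) ^ 4 * ∑ y ∈ box 4 L, |v (s • siteToE y)|) +
        C₂ * (s / κ) ^ 4 * ∑ x ∈ box 4 L, ∑ y ∈ box 4 L,
          |thetaTest 4 v (s • siteToE x)| * |v (s • siteToE y)| / (1 + ‖siteToE (y - x)‖) ^ 4 ≤
      Q2 G r β L s (thetaTest 4 v) v)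
    (g : G) :
    ε + 2 * (6 * ((r.N : ℝ) - (r.ρ g).trace.re) * (s / κ) ^ 4 * ∑ x ∈ box 4 L, |thetaTest 4 v (s • siteToE x)|) *
        (6 * ((r.N : ℝ) - (r.ρ g).trace.re) * (s / κ) ^ 4 * ∑ y ∈ box 4 L, |v (s • siteToE y)|) ≤
      Q2 G r β L s (thetaTest 4 v) v := by
  have hDC := six_mul_sub_trace_le_of_e1osc_at G r β hsℓ hE1 g
  have hD := six_mul_sub_trace_nonneg r g
  have hSθ : 0 ≤ ∑ x ∈ box 4 L, |thetaTest 4 v (s • siteToE x)| := Finset.sum_nonneg fun _ _ => abs_nonneg _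
  have hSv : 0 ≤ ∑ y ∈ box 4 L, |v (s • siteToE y)| := Finset.sum_nonneg fun _ _ => abs_nonneg _
  have hE2 : 0 ≤ C₂ * (s / κ) ^ 4 * ∑ x ∈ box 4 L, ∑ y ∈ box 4 L,
      |thetaTest 4 v (s • siteToE x)| * |v (s • siteToE y)| / (1 + ‖siteToE (y - x)‖) ^ 4 := by
    refine mul_nonneg (mul_nonneg hC₂ (by positivity)) (Finset.sum_nonneg fun x _ => Finset.sum_nonneg fun y _ => ?_)
    positivity
  have hmono := marginKK_mono (t := (s / κ) ^ 4) hD hDC (by positivity) hSθ hSv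
  linarith

/-- **The corner floor of the margin, canonical form.**  Let `a > 0`, `a → 0`; assume clause 1 of the registered package
(range `ℓ > 0`) and its clause 4 VERBATIM for a witness `v` supported in the ball of radius `σ` (`C₂ ≥ 0`, `κ > 0`, reference
tori `σ + κ + 1 ≤ aβ · L₀β`).  Then for every `g ∈ G` and every `e > 0`, eventually in `β`,
**`ε + 2 D² ‖v‖₁² / κ⁸ − e ≤ Q2_{β,L₀β,aβ}(θv, v)`**, `D = 6 (N − Re tr ρ(g))`: an `ε`-INDEPENDENT floor that every
instance of the registered stub exhibits on its reference tori. [folklore] -/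
theorem q2_ge_cornerMargin_canonical (a : ℝ → ℝ) (ha : ∀ β, 0 < a β) (ha0 : Tendsto a atTop (𝓝 0))
    {C₁ C₂ ℓ κ σ : ℝ} (hC₂ : 0 ≤ C₂) (hκ : 0 < κ) (hℓ : 0 < ℓ)
    (hE1 : ∃ β₁ : ℝ, ∀ β : ℝ, β₁ ≤ β → ∀ (c : Fin 4 → ℤ) (b : ℕ), (b : ℝ) * a β ≤ ℓ →
      ∀ (η η' : LGConfig 4 G) (x : Fin 4 → ℤ), 1 ≤ depth c b x →
        |kerE G r β c b η (dens G r x) - kerE G r β c b η' (dens G r x)| ≤ C₁ / (depth c b x : ℝ) ^ 4)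
    {v : 𝓢(EuclideanSpace ℝ (Fin 4), ℝ)} (hvσ : tsupport (v : EuclideanSpace ℝ (Fin 4) → ℝ) ⊆ Metric.closedBall 0 σ)
    {ε β₅ : ℝ} {L₀ : ℝ → ℕ}
    (hfloor : ∀ β : ℝ, β₅ ≤ β → σ + κ + 1 ≤ a β * L₀ β ∧
      ε + 2 * (C₁ * (a β / κ) ^ 4 * ∑ x ∈ box 4 (L₀ β), |thetaTest 4 v (a β • siteToE x)|) *
            (C₁ * (a β / κ) ^ 4 * ∑ y ∈ box 4 (L₀ β), |v (a β • siteToE y)|) +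
          C₂ * (a β / κ) ^ 4 * ∑ x ∈ box 4 (L₀ β), ∑ y ∈ box 4 (L₀ β),
            |thetaTest 4 v (a β • siteToE x)| * |v (a β • siteToE y)| / (1 + ‖siteToE (y - x)‖) ^ 4 ≤
        Q2 G r β (L₀ β) (a β) (thetaTest 4 v) v)
    (g : G) {e : ℝ} (he : 0 < e) :
    ∀ᶠ β in atTop, ε + 2 * (6 * ((r.N : ℝ) - (r.ρ g).trace.re)) ^ 2 * (∫ y, |v y|) ^ 2 / κ ^ 8 - e ≤
      Q2 G r β (L₀ β) (a β) (thetaTest 4 v) v := by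
  obtain ⟨β₁, H1⟩ := hE1
  set D : ℝ := 6 * ((r.N : ℝ) - (r.ρ g).trace.re) with hD_def
  have hL : ∀ᶠ β in atTop, σ ≤ a β * L₀ β := by
    filter_upwards [eventually_ge_atTop β₅] with β hβ5
    linarith [(hfloor β hβ5).1, hκ]
  have hlim := CeilingPrice.marginKK_tendsto_canonical v hvσ a L₀ ha ha0 hL D κ
  have hnear : ∀ᶠ β in atTop, 2 * D ^ 2 * (∫ y, |v y|) ^ 2 / κ ^ 8 - e <
      2 * (D * (a β / κ) ^ 4 * ∑ x ∈ box 4 (L₀ β), |thetaTest 4 v (a β • siteToE x)|) *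
        (D * (a β / κ) ^ 4 * ∑ y ∈ box 4 (L₀ β), |v (a β • siteToE y)|) :=
    hlim.eventually (lt_mem_nhds (by linarith))
  filter_upwards [hnear, eventually_le_of_tendsto_zero ha0 hℓ, eventually_ge_atTop β₁, eventually_ge_atTop β₅]
    with β hβn hβℓ hβ1 hβ5
  have h := q2_ge_cornerMargin_of_clause4_at G r β hC₂ hβℓ (H1 β hβ1) (hfloor β hβ5).2 g
  rw [← hD_def] at h
  linarith

end Margin

end Summit.QuantumFields.YangMills.Cruxes.NT.CornerPrice

end
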